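import Literature.Probability.RandomPlanarGeometry.SwallowingProbCalculus
import HarnessLib

/-!
# The same-side swallowing kernel `u^{-2a}(u-1)^{-2a}` on `(1, ∞)` and its primitive

Trunk T-STOCH; deterministic special-function layer for the **same-side two-point problem** of the
real SLE_κ flow (two boundary points `0 < y < x` on the same side of the origin), the weak form of
S. Rohde, O. Schramm, *Basic properties of SLE*, Ann. of Math. 161 (2005), Lemma 6.6 (p. 908:
"`P[X ≥ s]`", `X = inf([1, ∞) ∩ γ[0, ∞))`, "obtained by substituting `1/Y_t`,
`Y_t = (g_t(1) - ξ(t))/(g_t(s) - ξ(t))`, for `s` in the right-hand side of (6.13)") needed for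
Lemma 7.3 (intervals swallowed at once).

For `0 < y < x`, Lawler's ratio `Z = X/(X - Y)` of the two real flows (*Conformally Invariant
Processes in the Plane* (2005), proof of Prop. 6.33) lives in `(1, ∞)` instead of `(0, 1)`, and
satisfies the same SDE, so that the same hypergeometric equation (6.21)
`u(1-u)ψ'' + (2a - 4au)ψ' = 0`, `a = 2/κ`, governs its hitting probabilities; on the branch `u > 1`
its increasing solutions have derivative `u^{-2a}(u-1)^{-2a}`. This file provides:

* `sameSideKernel a u = u^{-2a} (u-1)^{-2a}` (positive and smooth on `(1, ∞)`,
  `hasDerivAt_sameSideKernel`: `K' = K · (-2a/u + 2a/(1-u))`, the same shape as Lawler's kernel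
  so that `lawler_drift_identity` applies verbatim downstream);
* `sameSideH a z = ∫₂ᶻ K_a` — a primitive based at `2` (no endpoint singularity is needed for the
  positivity argument): `hasDerivAt_sameSideH`, `contDiffOn_sameSideH`, strict monotonicity, and
  **boundedness above on `(1, ∞)` for `a > 1/4`** (`κ < 8`; `sameSideH_le`), since
  `K_a(u) ≤ 2^{2a} u^{-4a}` for `u ≥ 2` and `4a > 1`.

## References

* S. Rohde, O. Schramm, *Basic properties of SLE*, Ann. of Math. 161 (2005), Lemma 6.6, eq. (6.13).
* G. F. Lawler, *Conformally Invariant Processes in the Plane*, AMS (2005), Prop. 6.33, eq. (6.21).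
-/

noncomputable section

open Set Filter Topology MeasureTheory
open scoped NNReal

namespace Literature.Probability.RandomPlanarGeometry

variable {a : ℝ}

/-! ### The kernel on `(1, ∞)` -/

/-- The **same-side swallowing kernel** `K_a(u) = u^{-2a} (u-1)^{-2a}` (as `Real.rpow`; used on
`u > 1`, junk elsewhere): the derivative of the increasing solutions of Lawler's (6.21) on the
branch `u > 1`. [cite: Lawler2005, eq. (6.21)] -/
def sameSideKernel (a u : ℝ) : ℝ :=
  u ^ (-(2 * a)) * (u - 1) ^ (-(2 * a))

/-- The kernel is positive on `(1, ∞)`. [folklore] -/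
theorem sameSideKernel_pos (a : ℝ) {u : ℝ} (hu : 1 < u) : 0 < sameSideKernel a u :=
  mul_pos (Real.rpow_pos_of_pos (by linarith) _) (Real.rpow_pos_of_pos (by linarith) _)

/-- The kernel is smooth on `(1, ∞)`. [folklore] -/
theorem contDiffOn_sameSideKernel (a : ℝ) {n : ℕ∞} : ContDiffOn ℝ n (sameSideKernel a) (Ioi 1) := by
  intro u hu
  have hu' : (1 : ℝ) < u := hu
  have h1 : ContDiffAt ℝ n (fun u : ℝ ↦ u ^ (-(2 * a))) u :=
    Real.contDiffAt_rpow_const_of_ne (by linarith)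
  have h2 : ContDiffAt ℝ n (fun u : ℝ ↦ (u - 1) ^ (-(2 * a))) u :=
    (Real.contDiffAt_rpow_const_of_ne (by linarith : (u - 1) ≠ 0)).comp u
      (contDiffAt_id.sub contDiffAt_const)
  exact (h1.mul h2).contDiffWithinAt

/-- The kernel is continuous on `(1, ∞)`. [folklore] -/
theorem continuousOn_sameSideKernel (a : ℝ) : ContinuousOn (sameSideKernel a) (Ioi 1) :=
  (contDiffOn_sameSideKernel a (n := 0)).continuousOn

/-- **`K' = K · (-2a/u + 2a/(1-u))`** on `(1, ∞)` (the same shape as for Lawler's kernel on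
`(0, 1)`, `hasDerivAt_swallowingKernel`). [folklore] -/
theorem hasDerivAt_sameSideKernel (a : ℝ) {u : ℝ} (hu : 1 < u) :
    HasDerivAt (sameSideKernel a) (sameSideKernel a u * (-(2 * a) / u + 2 * a / (1 - u))) u := by
  have hu0 : u ≠ 0 := by linarith
  have hu1 : u - 1 ≠ 0 := by linarith
  have h1 : HasDerivAt (fun x : ℝ ↦ x ^ (-(2 * a))) (1 * (-(2 * a)) * u ^ (-(2 * a) - 1)) u :=
    (hasDerivAt_id u).rpow_const (Or.inl hu0)
  have h2 : HasDerivAt (fun x : ℝ ↦ (x - 1) ^ (-(2 * a))) (1 * (-(2 * a)) * (u - 1) ^ (-(2 * a) - 1)) u :=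
    ((hasDerivAt_id u).sub_const 1).rpow_const (Or.inl hu1)
  have h := h1.mul h2
  refine h.congr_deriv ?_
  simp only [sameSideKernel]
  rw [Real.rpow_sub_one hu0, Real.rpow_sub_one hu1]
  have h1u : (1 : ℝ) - u ≠ 0 := by linarith
  field_simp
  ring

/-- The kernel is integrable on every compact subinterval of `(1, ∞)`. [folklore] -/
theorem intervalIntegrable_sameSideKernel (a : ℝ) {r s : ℝ} (hr : 1 < r) (hs : 1 < s) :
    IntervalIntegrable (sameSideKernel a) volume r s :=
  ((continuousOn_sameSideKernel a).mono fun u hu ↦ by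
    rcases le_total r s with h | h
    · rw [uIcc_of_le h] at hu; exact lt_of_lt_of_le hr hu.1
    · rw [uIcc_of_ge h] at hu; exact lt_of_lt_of_le hs hu.1).intervalIntegrable

/-- **`K_a(u) ≤ 2^{2a} u^{-4a}` for `u ≥ 2`, `a ≥ 0`** (`u - 1 ≥ u/2`). [folklore] -/
theorem sameSideKernel_le (ha : 0 ≤ a) {u : ℝ} (hu : 2 ≤ u) :
    sameSideKernel a u ≤ (2 : ℝ) ^ (2 * a) * u ^ (-(4 * a)) := by
  have hu0 : 0 < u := by linarith
  have h1 : (u - 1) ^ (-(2 * a)) ≤ (u / 2) ^ (-(2 * a)) :=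
    Real.rpow_le_rpow_of_nonpos (by positivity) (by linarith) (by linarith)
  have h2 : (u / 2) ^ (-(2 * a)) = (2 : ℝ) ^ (2 * a) * u ^ (-(2 * a)) := by
    rw [Real.div_rpow hu0.le zero_le_two, Real.rpow_neg zero_le_two, div_eq_mul_inv, inv_inv, mul_comm]
  calc sameSideKernel a u = u ^ (-(2 * a)) * (u - 1) ^ (-(2 * a)) := rfl
    _ ≤ u ^ (-(2 * a)) * ((2 : ℝ) ^ (2 * a) * u ^ (-(2 * a))) := by
        rw [← h2]; exact mul_le_mul_of_nonneg_left h1 (Real.rpow_nonneg hu0.le _)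
    _ = (2 : ℝ) ^ (2 * a) * u ^ (-(4 * a)) := by
        rw [show -(4 * a) = -(2 * a) + -(2 * a) by ring, Real.rpow_add hu0]; ring

/-! ### The primitive `∫₂ᶻ K_a` -/

/-- The **same-side scale function** `h_a(z) = ∫₂ᶻ u^{-2a}(u-1)^{-2a} du` (a primitive of the
kernel on `(1, ∞)` based at `2`; increasing, and bounded above when `a > 1/4`). Up to an affine
normalisation it is the hitting probability of Lawler's ratio on the branch `(1, ∞)`, i.e.
Rohde–Schramm's (6.13) read through `1/Y_t`. [cite: RohdeSchramm2005, Lemma 6.6] -/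
def sameSideH (a z : ℝ) : ℝ :=
  ∫ u in (2 : ℝ)..z, sameSideKernel a u

/-- `h_a(2) = 0`. [folklore] -/
@[simp]
theorem sameSideH_two (a : ℝ) : sameSideH a 2 = 0 := by
  simp [sameSideH]

/-- **`h_a' = K_a` on `(1, ∞)`** (fundamental theorem of calculus). [folklore] -/
theorem hasDerivAt_sameSideH (a : ℝ) {z : ℝ} (hz : 1 < z) :
    HasDerivAt (sameSideH a) (sameSideKernel a z) z := by
  have hcont := continuousOn_sameSideKernel a
  refine intervalIntegral.integral_hasDerivAt_right (intervalIntegrable_sameSideKernel a one_lt_two hz) ?_ ?_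
  · exact hcont.stronglyMeasurableAtFilter isOpen_Ioi _ hz
  · exact hcont.continuousAt (isOpen_Ioi.mem_nhds hz)

/-- `deriv h_a = K_a` on `(1, ∞)`. [folklore] -/
theorem deriv_sameSideH (a : ℝ) {z : ℝ} (hz : 1 < z) : deriv (sameSideH a) z = sameSideKernel a z :=
  (hasDerivAt_sameSideH a hz).deriv

/-- `h_a` is smooth on `(1, ∞)` (its derivative is the smooth kernel). [folklore] -/
theorem contDiffOn_sameSideH (a : ℝ) {n : ℕ} : ContDiffOn ℝ (n + 1) (sameSideH a) (Ioi 1) := by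
  rw [contDiffOn_succ_iff_deriv_of_isOpen isOpen_Ioi]
  refine ⟨fun z hz ↦ (hasDerivAt_sameSideH a hz).differentiableAt.differentiableWithinAt,
    fun h ↦ absurd h (by exact_mod_cast WithTop.coe_ne_top), ?_⟩
  exact (contDiffOn_sameSideKernel a).congr fun z hz ↦ deriv_sameSideH a hz

/-- `h_a` is `C²` on `(1, ∞)`. [folklore] -/
theorem contDiffOn_two_sameSideH (a : ℝ) : ContDiffOn ℝ 2 (sameSideH a) (Ioi 1) :=
  contDiffOn_sameSideH a (n := 1)

/-- `h_a` is strictly increasing on `(1, ∞)` (positive derivative). [folklore] -/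
theorem strictMonoOn_sameSideH (a : ℝ) : StrictMonoOn (sameSideH a) (Ioi 1) :=
  strictMonoOn_of_deriv_pos (convex_Ioi 1)
    ((contDiffOn_two_sameSideH a).continuousOn)
    fun z hz ↦ by
      rw [interior_Ioi] at hz
      rw [deriv_sameSideH a hz]
      exact sameSideKernel_pos a hz

/-- The difference `h_a(z) - h_a(w)` is the integral of the kernel from `w` to `z`. [folklore] -/
theorem sameSideH_sub (a : ℝ) {w z : ℝ} (hw : 1 < w) (hz : 1 < z) :
    sameSideH a z - sameSideH a w = ∫ u in w..z, sameSideKernel a u := by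
  simp only [sameSideH]
  rw [← intervalIntegral.integral_interval_sub_left (intervalIntegrable_sameSideKernel a one_lt_two hz)
    (intervalIntegrable_sameSideKernel a one_lt_two hw)]

/-- **`h_a` is bounded above on `(1, ∞)` when `a > 1/4`**: for `z ≥ 2`,
`h_a(z) = ∫₂ᶻ K_a ≤ 2^{2a} ∫₂ᶻ u^{-4a} du ≤ 2^{2a} · 2^{1-4a}/(4a - 1)`, and `h_a ≤ 0` on `(1, 2]`.
This is where `κ < 8` (`a = 2/κ > 1/4`) enters the same-side problem: the scale function is
finite at `+∞`. [cite: RohdeSchramm2005, Lemma 6.6] -/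
theorem sameSideH_le (ha : 1 / 4 < a) {z : ℝ} (hz : 1 < z) :
    sameSideH a z ≤ (2 : ℝ) ^ (2 * a) * ((2 : ℝ) ^ (1 - 4 * a) / (4 * a - 1)) := by
  have ha0 : 0 ≤ a := by linarith
  have hC : 0 ≤ (2 : ℝ) ^ (2 * a) * ((2 : ℝ) ^ (1 - 4 * a) / (4 * a - 1)) := by
    have : 0 < 4 * a - 1 := by linarith
    positivity
  rcases le_or_gt z 2 with hz2 | hz2
  · -- `h ≤ 0 = h(2)` on `(1, 2]` by monotonicity
    have hmono := (strictMonoOn_sameSideH a).monotoneOn hz (show (1 : ℝ) < 2 by norm_num) hz2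
    rw [sameSideH_two] at hmono
    exact hmono.trans hC
  · have hK : ∀ u ∈ Icc (2 : ℝ) z, sameSideKernel a u ≤ (2 : ℝ) ^ (2 * a) * u ^ (-(4 * a)) :=
      fun u hu ↦ sameSideKernel_le ha0 hu.1
    have hI1 : IntervalIntegrable (sameSideKernel a) volume 2 z :=
      intervalIntegrable_sameSideKernel a one_lt_two hz
    have hI2 : IntervalIntegrable (fun u : ℝ ↦ (2 : ℝ) ^ (2 * a) * u ^ (-(4 * a))) volume 2 z := by
      refine (intervalIntegral.intervalIntegrable_rpow (r := -(4 * a)) (Or.inr ?_)).const_mul _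
      rw [uIcc_of_le hz2.le]
      exact fun h ↦ by linarith [h.1]
    have h1 : sameSideH a z ≤ ∫ u in (2 : ℝ)..z, (2 : ℝ) ^ (2 * a) * u ^ (-(4 * a)) :=
      intervalIntegral.integral_mono_on hz2.le hI1 hI2 hK
    refine h1.trans ?_
    rw [intervalIntegral.integral_const_mul]
    refine mul_le_mul_of_nonneg_left ?_ (by positivity)
    have h4a : -(4 * a) + 1 ≠ 0 := by linarith
    rw [integral_rpow (Or.inr ⟨by linarith, by
      rw [uIcc_of_le hz2.le]; exact fun h ↦ by linarith [h.1]⟩)]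
    have h4a' : 0 < 4 * a - 1 := by linarith
    have hzpow : 0 ≤ z ^ (1 - 4 * a) := Real.rpow_nonneg (by linarith) _
    have key : (z ^ (-(4 * a) + 1) - 2 ^ (-(4 * a) + 1)) / (-(4 * a) + 1) =
        ((2 : ℝ) ^ (1 - 4 * a) - z ^ (1 - 4 * a)) / (4 * a - 1) := by
      rw [show -(4 * a) + 1 = 1 - 4 * a by ring]
      have h1 : (1 : ℝ) - 4 * a ≠ 0 := by linarith
      field_simp
      ring
    rw [key, div_le_div_iff_of_pos_right h4a']
    linarith

end Literature.Probability.RandomPlanarGeometry
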